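import Literature.Barriers.ValiantsHypothesis.BILPS19Cor42OfPIT
import Literature.Computability.AlgebraicComplexity.PITLanguageCoRP
import HarnessLib

/-!
# Bläser–Ikenmeyer–Lysikov–Pandey–Schreyer 2019, Cor 42 — DISCHARGED

Theorem-only closer of the typed fact `BILPS2019_cor42 F` (`BILPS19MembershipHardness.lean`, val-lit
X5-BILPS19 §8): the reduction of Cor 42 to a `BPP` identity test for integer circuit words
(`BILPS19Cor42OfPIT.lean`: `BILPS2019_cor42_of_PIT_mem_BPP`, the printed `∃BPP` verifier of BILPS
Thm 40 for the minrank variety `𝓜_1` assembled from the pencil cover, the verifier circuits, their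
polynomial-time writers and `P^{BPP} = BPP`) meets the tree's unconditional
`PITLanguage_mem_BPP : PITLanguage ∈ BPP` (`PITLanguageCoRP.lean`: ACIT over `ℤ` is in `coRP ⊆ BPP`,
Ibarra–Moran 1983 / Kabanets–Impagliazzo 2003 Lemma 8, proved in the tree by the randomised modular
zero test). Hence **`BILPS2019_cor42_holds : BILPS2019_cor42 F`** for every field `F` of
characteristic `0`, as typed: "for infinitely many `n`, there is an `m`, a tensor `t ∈ S^{m×n×n}` and
a value `r` such that there is no algebraic `poly(n)`-natural proof for the fact that the minrank of
`t` is greater than `r` unless `coNP ⊆ ∃BPP`" (arXiv:1911.02534, Cor. 42, p0035:L37; `S = ℚ`,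
constant-free natural proofs of size `≤ n^c + c`, module docstring (3) of the statement file).

No definitions, no new facts. HONEST FRAMING (val-lit): a published CONDITIONAL barrier about the
MINRANK varieties (hypothesis `coNP ⊄ ∃BPP` kept as the antecedent of the typed statement), now a
theorem of the tree; it says nothing about `VP`, the determinant orbit closure or border rank, and
`VP ≠ VNP` is NOT proved.

## References

* [BlaserIkenmeyerLysikovPandeySchreyer2019] M. Bläser, C. Ikenmeyer, V. Lysikov, A. Pandey,
  F.-O. Schreyer, *Variety membership testing, algebraic natural proofs, and geometric complexity
  theory*, arXiv:1911.02534, §8.3 Thm. 40, Cor. 42 (p0035:L37).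
* [KabanetsImpagliazzo2003] V. Kabanets, R. Impagliazzo, STOC 2003, Lemma 8 (p. 357).
-/

namespace Literature.Barriers.ValiantsHypothesis

open Literature.Computability.AlgebraicComplexity

universe u

/-- **Discharge of `BILPS2019_cor42`** (BILPS Cor 42, the minrank instance of the `∃BPP` barrier
Thm 40): the reduction `BILPS2019_cor42_of_PIT_mem_BPP` applied to the tree's `PITLanguage ∈ BPP`.
The statement is the closed universal closure over the fact's OWN parameters — the field `F` with its
`Field`/`CharZero` instances, exactly the binders of `def BILPS2019_cor42` — and carries no hypothesis
(same shape as `CKRST2020_thm_1_2_holds`).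
[cite: BlaserIkenmeyerLysikovPandeySchreyer2019, Cor. 42] -/
theorem BILPS2019_cor42_holds : ∀ (F : Type u) [Field F] [CharZero F], BILPS2019_cor42 F :=
  fun F _ _ => BILPS2019Cor42.BILPS2019_cor42_of_PIT_mem_BPP F PITLanguage_mem_BPP

end Literature.Barriers.ValiantsHypothesis
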